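import Mathlib.NumberTheory.PrimeCounting
import Literature.Computability.AlgebraicComplexity.BurgisserBooleanPartsA3Assembly
import Literature.NumberTheory.LFunctions.DegreeOnePrimesDiscriminantBound
import Literature.NumberTheory.LFunctions.PrimeIdealCountDegreeOne
import Literature.NumberTheory.LFunctions.PrimeIdealCountRat
import HarnessLib

/-!
# Bürgisser's Corollary 4.8 from the effective prime ideal theorem under GRH

Trunk T-CPLX-ALG. Bürgisser, *Cook's versus Valiant's hypothesis*, TCS 235 (2000), §4.2, proves
**Corollary 4.8** — under GRH, an irreducible `g ∈ ℤ[Y]` of degree `d` and weight `w` has a root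
modulo at least `π(x)/d − O(x^{1/2} log(dwx) + d log(dw))` primes `p ≤ x` — from the effective
prime ideal theorem under GRH (eq. (3), p. 83: Weinberger; Lagarias–Odlyzko) via Theorem 4.7
(Weinberger). Cor. 4.8 is the named fact `rootModPrimeCount_lower_bound_of_GRH` of
`BurgisserReductionModPrimes.lean`, one of the two external inputs left in the tree's proof of
Bürgisser's transfer theorem `VP_k = VNP_k ⟹ P/poly = NP/poly` (char. 0, GRH;
`PPoly_eq_polyAdvice_NP_of_VP_eq_VNP k`, `ValiantBooleanBridge.lean`). This file PROVES Cor. 4.8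
from the canonical analytic statement, the named fact
`Literature.NumberTheory.LFunctions.NumberField.effectivePrimeIdealTheorem_of_ERH`
(`EffectivePrimeIdealTheoremGRH.lean`: Serre 1981, Thm. 4 (14_R); Lagarias–Odlyzko 1977,
Thm. 1.1), so that the target fact now rests on exactly two external theorems: Krick–Pardo's
height bound (TCS Thm. 4.5, `algebraicSolution_height_bound`) and the GRH prime ideal theorem
(`PPoly_eq_polyAdvice_NP_of_VP_eq_VNP_of_heightBound_of_effectivePrimeIdealTheorem`).

## The printed proof (TCS pp. 83–84) and its formalisation

"Let `g` be an irreducible univariate integer polynomial of degree `d`. […] there is a bijection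
between the irreducible factors of `g` modulo `p` and the primes of the number field
`K = ℚ[Y]/(g)` lying over `p`, provided `p` is not a divisor of the discriminant `Δ` of `g`.
Under this bijection, the roots of `g` modulo `p` correspond to the primes of degree one lying
over `p`. […] (3) `|π_K(x) − li(x)| = O(x^{1/2} log(|Δ| x^d))` […] A prime ideal of `K` having
norm `≤ x` and degree `> 1` lies over a rational prime `p ≤ x^{1/2}`. Hence there are at most
`d x^{1/2}` such primes of `K`. Moreover, there are at most `log |Δ|` prime factors of `Δ`. By
taking into account these considerations, and using also the effective prime number theorem for
`ℚ`, one can easily deduce from (3) [Theorem 4.7:] `|N_g(x) − π(x)| = O(x^{1/2} log(|Δ| x^d) +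
d log |Δ|)` […] It is obvious that `N_g(x) ≤ d π_g(x)`. Moreover, if `w` is an upper bound on
the weight of `g`, then we have the estimate `log |Δ| = O(d log(dw))` […] Corollary 4.8."

Formalisation (only the lower bound for `π_g` is needed, which shortcuts Thm. 4.7):
* `primeIdealCount_le_card_degreeOnePrimesLE` — for any number field, `π_K(x) ≤ n_K · #{p ≤ x :
  c_K(p) ≠ 0} + n_K ⌊√x⌋`, from the tree's `primeIdealCount_le_sum_idealNormCount_add`
  (`PrimeIdealCountDegreeOne.lean`: primes of degree `≥ 2` are at most `n_K π(√x)`) and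
  `c_K(p) ≤ n_K` (`idealNormCount_prime_le_finrank`);
* `card_degreeOnePrimesLE_rootField_le` — for `K = ℚ[Y]/(g)` (`DegreeOnePrimes.RootField g`) an
  ideal of norm `p` with `p ∤ a_d` gives a root of `g` modulo `p`
  (`DegreeOnePrimes.exists_root_mod_of_absNorm_eq`, `DegreeOnePrimesDiscriminantBound.lean`,
  valid at every `p ∤ a_d` — no discriminant condition is needed in this direction), so the count
  is `≤ π_g(x) + ω(|a_d|)`, and `ω(|a_d|) log 2 ≤ log |a_d| ≤ log w` replaces "at most `log |Δ|`
  prime factors";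
* `DegreeOnePrimes.log_abs_discr_rootField_le` — `log |d_K| ≤ d log d + 2d log w` (the field
  discriminant, which is what (3) involves; via the integral tail family of
  `DegreeOnePrimesTailOrder.lean` and the Landau–Mahler inequality);
* the fact `effectivePrimeIdealTheorem_of_ERH` at `K` and at `ℚ` (`PrimeIdealCountRat.lean`:
  `π_ℚ = π`, `d_ℚ = 1`), and the bookkeeping `cor48_bookkeeping` giving the printed shape with
  the absolute constant `K = 5c + 2`.

## Design choices

* We prove exactly the statement vendored as `rootModPrimeCount_lower_bound_of_GRH` (all
  irreducible `g ∈ ℤ[Y]` of positive degree, not necessarily monic or primitive — irreducibility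
  in `ℤ[Y]` with `deg g ≥ 1` forces primitivity), so that the existing combination
  `reduction_mod_primes_of_GRH_of_facts` applies verbatim.
* The hypothesis of the fact is the universal `ExtendedRiemannHypothesis`; it is instantiated at
  the stem field and at `ℚ`.

## References

* P. Bürgisser, *Cook's versus Valiant's hypothesis*, Theoret. Comput. Sci. 235 (2000) 71–88,
  §4.2: eq. (3) and Thm. 4.7 (p. 83), Cor. 4.8 (p. 84) (`Burgisser2000TCS`).
* P. J. Weinberger, *Finding the number of factors of a polynomial*, J. Algorithms 5 (1984)
  180–186 (Bürgisser's [29], the source of Thm. 4.7).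
* J.-P. Serre, *Quelques applications du théorème de densité de Chebotarev*, Publ. Math. IHÉS 54
  (1981), Thm. 4 (`Serre1981`); J. C. Lagarias, A. M. Odlyzko, *Effective versions of the
  Chebotarev density theorem* (1977), Thm. 1.1 (`LagariasOdlyzko1977`).
-/

noncomputable section

open scoped Classical NumberField
open Polynomial Finset Literature.NumberTheory.LFunctions
  Literature.NumberTheory.LFunctions.NumberField

namespace Literature.Computability.AlgebraicComplexity

/-! ### From the degree-one count `∑_{p ≤ x} c_K(p)` to the primes with `c_K(p) ≠ 0` -/

section Counting

variable (K : Type*) [Field K] [NumberField K]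

/-- `π(m) ≤ m` (no prime is `0`). [folklore] -/
theorem primeCounting_le_self (m : ℕ) : Nat.primeCounting m ≤ m := by
  rw [Nat.primeCounting, Nat.primeCounting', Nat.count_eq_card_filter_range]
  calc ((range (m + 1)).filter Nat.Prime).card ≤ ((range (m + 1)).erase 0).card := by
        refine card_le_card fun p hp => ?_
        rw [mem_filter] at hp
        exact mem_erase.mpr ⟨hp.2.ne_zero, hp.1⟩
    _ = m := by rw [card_erase_of_mem (by simp), card_range]; rfl

/-- The rational primes `p ≤ x` above which `K` has an ideal of norm `p` (a prime of degree one).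
[folklore] -/
def degreeOnePrimesLE (x : ℕ) : Finset ℕ :=
  (range (x + 1)).filter fun p => p.Prime ∧ ∃ I : Ideal (𝓞 K), Ideal.absNorm I = p

/-- **`∑_{p ≤ x} c_K(p) ≤ [K:ℚ] · #{p ≤ x : c_K(p) ≠ 0}`**: each `c_K(p) ≤ [K:ℚ]`
(`idealNormCount_prime_le_finrank`) and `c_K(p) = 0` unless some ideal has norm `p`.
[cite: Burgisser2000TCS, §4.2 p. 83] -/
theorem sum_idealNormCount_le_finrank_mul_card (x : ℕ) :
    ∑ p ∈ (range (x + 1)).filter Nat.Prime, idealNormCount K p ≤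
      Module.finrank ℚ K * (degreeOnePrimesLE K x).card := by
  rw [← sum_filter_add_sum_filter_not ((range (x + 1)).filter Nat.Prime)
    (fun p => ∃ I : Ideal (𝓞 K), Ideal.absNorm I = p), filter_filter]
  have h0 : ∑ p ∈ ((range (x + 1)).filter Nat.Prime).filter
      (fun p => ¬ ∃ I : Ideal (𝓞 K), Ideal.absNorm I = p), idealNormCount K p = 0 := by
    refine sum_eq_zero fun p hp => ?_
    have hne := (mem_filter.mp hp).2
    rw [idealNormCount]
    haveI : IsEmpty {I : Ideal (𝓞 K) // Ideal.absNorm I = p} :=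
      ⟨fun I => hne ⟨I.1, I.2⟩⟩
    exact Nat.card_of_isEmpty
  rw [h0, add_zero, degreeOnePrimesLE, mul_comm]
  refine le_trans (sum_le_card_nsmul _ _ (Module.finrank ℚ K) fun p hp => ?_) (by
    rw [smul_eq_mul])
  exact idealNormCount_prime_le_finrank K (mem_filter.mp hp).2.1

/-- **`π_K(x) ≤ [K:ℚ] · #{p ≤ x : c_K(p) ≠ 0} + [K:ℚ] · √x`** (from
`primeIdealCount_le_sum_idealNormCount_add`: primes of degree `≥ 2` are at most `[K:ℚ] π(√x)`;
Bürgisser 2000 TCS, p. 83). [cite: Burgisser2000TCS, §4.2 p. 83] -/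
theorem primeIdealCount_le_card_degreeOnePrimesLE (x : ℕ) :
    primeIdealCount K x ≤
      Module.finrank ℚ K * (degreeOnePrimesLE K x).card + Module.finrank ℚ K * Nat.sqrt x :=
  (primeIdealCount_le_sum_idealNormCount_add K x).trans (Nat.add_le_add
    (sum_idealNormCount_le_finrank_mul_card K x)
    (Nat.mul_le_mul_left _ (primeCounting_le_self _)))

end Counting

/-! ### The stem field of `g`: degree-one primes give roots of `g` modulo `p` -/

section RootFieldCount

variable (g : ℤ[X]) [Fact (Irreducible (g.map (algebraMap ℤ ℚ)))]

/-- **`#{p ≤ x : some prime of degree one above p in ℚ[Y]/(g)} ≤ π_g(x) + ω(|a_d|)`**: above a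
prime `p ∤ a_d` an ideal of norm `p` yields a root of `g` modulo `p`
(`DegreeOnePrimes.exists_root_mod_of_absNorm_eq`); the primes dividing `a_d` are at most `ω(|a_d|)`
(Bürgisser 2000 TCS, p. 83: "there are at most `log |Δ|` prime factors of `Δ`", here with the
leading coefficient in place of the discriminant). [cite: Burgisser2000TCS, §4.2 pp. 83–84] -/
theorem card_degreeOnePrimesLE_rootField_le (x : ℕ) :
    (degreeOnePrimesLE (DegreeOnePrimes.RootField g) x).card ≤
      rootModPrimeCount g x + (g.leadingCoeff.natAbs).primeFactors.card := by
  unfold degreeOnePrimesLE rootModPrimeCount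
  refine le_trans (card_le_card ?_) (card_union_le _ _)
  intro p hp
  rw [mem_filter, mem_range] at hp
  obtain ⟨hpx, hprime, I, hI⟩ := hp
  rw [mem_union]
  by_cases hdiv : (p : ℤ) ∣ g.leadingCoeff
  · right
    exact Nat.mem_primeFactors.2 ⟨hprime, Int.natCast_dvd.mp hdiv,
      Int.natAbs_ne_zero.mpr (Polynomial.leadingCoeff_ne_zero.mpr
        (DegreeOnePrimes.ne_zero_of_fact_irreducible g))⟩
  · left
    rw [mem_filter, mem_range]
    exact ⟨hpx, hprime, DegreeOnePrimes.exists_root_mod_of_absNorm_eq g hprime hdiv hI⟩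

omit [Fact (Irreducible (g.map (algebraMap ℤ ℚ)))] in
/-- The weight `wt(g) = ∑ |a_i|` as a real sum over `0 ≤ i ≤ deg g`. [folklore] -/
theorem sum_abs_coeff_eq_polyWeight :
    ∑ i ∈ range (g.natDegree + 1), |(g.coeff i : ℝ)| = (polyWeight g : ℝ) := by
  rw [polyWeight, Nat.cast_sum, ← sum_subset supp_subset_range_natDegree_succ]
  · refine sum_congr rfl fun i _ => ?_
    rw [Nat.cast_natAbs, Int.cast_abs]
  · intro i _ hi
    rw [Polynomial.notMem_support_iff.mp hi, Int.cast_zero, abs_zero]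

end RootFieldCount

/-! ### The real bookkeeping of Corollary 4.8 -/

/-- The linear-combination step of Cor. 4.8: from `π_K ≤ D(N + ω) + Ds`,
`Li − cS(l_Δ + D l_x) ≤ π_K`, `π − cS l_x ≤ Li`, `l_Δ ≤ 3DL`, `ω ≤ 2L`, `s ≤ S` (all quantities
`≥ 0`, `D ≥ 1`, `l_x ≥ 1/2`) conclude `π/D − (5c+2)(S(L + l_x) + DL) ≤ N`. [folklore] -/
theorem cor48_bookkeeping {c D S L lX ldK ω s N πx πK Li : ℝ} (hc : 0 ≤ c) (hD : 1 ≤ D)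
    (hS : 0 ≤ S) (hL : 0 ≤ L) (hlX : 1 / 2 ≤ lX)
    (h1 : πK ≤ D * (N + ω) + D * s) (h2 : Li - c * S * (ldK + D * lX) ≤ πK)
    (h3 : πx - c * S * lX ≤ Li) (h4 : ldK ≤ 3 * D * L) (h5 : ω ≤ 2 * L) (h6 : s ≤ S) :
    πx / D - (5 * c + 2) * (S * (L + lX) + D * L) ≤ N := by
  have hDpos : 0 < D := by linarith
  rw [sub_le_iff_le_add, div_le_iff₀ hDpos]
  have hcS : 0 ≤ c * S := mul_nonneg hc hS
  have e1 : c * S * ldK ≤ c * S * (3 * D * L) := mul_le_mul_of_nonneg_left h4 hcS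
  have e2 : D * ω ≤ D * (2 * L) := mul_le_mul_of_nonneg_left h5 hDpos.le
  have e3 : D * s ≤ D * S := mul_le_mul_of_nonneg_left h6 hDpos.le
  have e4 : D * L ≤ D * L * D := le_mul_of_one_le_right (mul_nonneg hDpos.le hL) hD
  have e5 : D * S ≤ D * S * (2 * lX) :=
    le_mul_of_one_le_right (mul_nonneg hDpos.le hS) (by linarith)
  have e6 : c * S * lX ≤ c * S * lX * D :=
    le_mul_of_one_le_right (mul_nonneg hcS (by linarith)) hD
  have e7 : 0 ≤ S * L * D := by positivity
  have e8 : 0 ≤ S * lX * D := mul_nonneg (mul_nonneg hS (by linarith)) hDpos.le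
  have e9 : 0 ≤ D * L * D := by positivity
  nlinarith [e1, e2, e3, e4, e5, e6, e7, e8, e9, mul_nonneg hc e7, mul_nonneg hc e8,
    mul_nonneg hc e9]

/-- Junk case `x ≤ 1` of Cor. 4.8: `π(x) = 0` and the error term is nonnegative. [folklore] -/
theorem cor48_small {K D W : ℝ} (hK : 0 ≤ K) (hD : 1 ≤ D) (hW : 1 ≤ W) {x : ℕ} (hx : x < 2)
    {N : ℝ} (hN : 0 ≤ N) :
    (Nat.primeCounting x : ℝ) / D - K * (Real.sqrt x * Real.log (D * W * x) + D * Real.log (D * W))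
      ≤ N := by
  have hπ : Nat.primeCounting x = 0 := by
    interval_cases x <;> decide
  rw [hπ, Nat.cast_zero, zero_div, zero_sub]
  have hDW : 1 ≤ D * W := one_le_mul_of_one_le_of_one_le hD hW
  have h1 : 0 ≤ Real.sqrt x * Real.log (D * W * x) := by
    interval_cases x
    · simp
    · rw [Nat.cast_one, mul_one]
      exact mul_nonneg (Real.sqrt_nonneg _) (Real.log_nonneg hDW)
  have h2 : 0 ≤ D * Real.log (D * W) := mul_nonneg (by linarith) (Real.log_nonneg hDW)
  nlinarith [mul_nonneg hK (add_nonneg h1 h2)]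

/-! ### Corollary 4.8 from the effective prime ideal theorem -/

/-- **Bürgisser's Corollary 4.8 from the effective prime ideal theorem under GRH**
(Bürgisser 2000 TCS, Cor. 4.8, p. 84, via Thm. 4.7 (Weinberger) and eq. (3) p. 83
(Lagarias–Odlyzko); the named fact `rootModPrimeCount_lower_bound_of_GRH` of
`BurgisserReductionModPrimes.lean`): the GRH-conditional effective prime ideal theorem with a
uniform error term (`effectivePrimeIdealTheorem_of_ERH`, Serre 1981 Thm. 4 (14_R)) implies that
under ERH, for every irreducible `g ∈ ℤ[Y]` of degree `d ≥ 1` and weight `≤ w`,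
`π_g(x) ≥ π(x)/d − K (x^{1/2} log(dwx) + d log(dw))` for all `x`, with an absolute `K`
(here `K = 5c + 2`, `c` the constant of the prime ideal theorem). Printed proof (pp. 83–84):
degree-one primes over `p ∤ disc` correspond to roots modulo `p`, primes of degree `≥ 2` are
`≤ d √x` in number, `log |Δ| = O(d log(dw))`, and the effective prime number theorem for `ℚ`
turns `Li(x)` into `π(x)`. Formalised with the leading coefficient `a_d` in place of the
discriminant for the exceptional primes (`ω(|a_d|) log 2 ≤ log w`), the field discriminant bound
`log |d_K| ≤ d log d + 2 d log w` (`DegreeOnePrimes.log_abs_discr_rootField_le`), and the `K = ℚ` instance of the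
same fact for `π(x)` (`abs_primeCounting_sub_offsetLogIntegral_le`).
[cite: Burgisser2000TCS, Thm. 4.7 and Cor. 4.8 pp. 83–84] -/
theorem rootModPrimeCount_lower_bound_of_GRH_of_effectivePrimeIdealTheorem
    (hPIT : effectivePrimeIdealTheorem_of_ERH) : rootModPrimeCount_lower_bound_of_GRH := by
  intro hERH
  obtain ⟨c, hc, H⟩ := hPIT
  refine ⟨5 * c + 2, by positivity, ?_⟩
  intro g w hirr hdeg hw x
  -- the stem field of `g`
  have hprim : g.IsPrimitive := hirr.isPrimitive hdeg.ne'
  haveI : Fact (Irreducible (g.map (algebraMap ℤ ℚ))) :=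
    ⟨(IsPrimitive.Int.irreducible_iff_irreducible_map_cast hprim).mp hirr⟩
  -- basic real parameters
  set D : ℝ := (g.natDegree : ℝ) with hD
  set W : ℝ := (w : ℝ) with hW
  have hD1 : 1 ≤ D := by rw [hD]; exact_mod_cast hdeg
  have hw1 : 1 ≤ polyWeight g := one_le_polyWeight hirr.ne_zero
  have hW1 : 1 ≤ W := by rw [hW]; exact_mod_cast hw1.trans hw
  have hN0 : (0 : ℝ) ≤ rootModPrimeCount g x := Nat.cast_nonneg _
  by_cases hx : x < 2
  · exact cor48_small (by positivity) hD1 hW1 hx hN0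
  have hx2 : 2 ≤ x := not_lt.mp hx
  have hX2 : (2 : ℝ) ≤ (x : ℝ) := by exact_mod_cast hx2
  -- the coefficient sum
  have hWsum : ∑ i ∈ range (g.natDegree + 1), |(g.coeff i : ℝ)| ≤ W := by
    rw [sum_abs_coeff_eq_polyWeight, hW]
    exact_mod_cast hw
  -- (F1) the effective prime ideal theorem for the stem field
  have hfin : Module.finrank ℚ (DegreeOnePrimes.RootField g) = g.natDegree :=
    DegreeOnePrimes.finrank_rootField g
  have HK := H (DegreeOnePrimes.RootField g) (hERH (DegreeOnePrimes.RootField g)) (x : ℝ) hX2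
  rw [hfin] at HK
  -- (F2) the effective prime number theorem for `ℚ`
  have HQ := abs_primeCounting_sub_offsetLogIntegral_le H hERH hX2
  rw [Nat.floor_natCast] at HQ
  -- (F3) the discriminant of the stem field
  have hdisc := DegreeOnePrimes.log_abs_discr_rootField_le (g := g) hWsum
  -- (F4) counting prime ideals
  have hcount : (primeIdealCount (DegreeOnePrimes.RootField g) (x : ℝ) : ℝ) ≤
      D * (rootModPrimeCount g x + (g.leadingCoeff.natAbs).primeFactors.card) +
        D * Nat.sqrt x := by
    have h := (primeIdealCount_le_card_degreeOnePrimesLE (DegreeOnePrimes.RootField g) x).trans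
      (Nat.add_le_add_right
        (Nat.mul_le_mul_left _ (card_degreeOnePrimesLE_rootField_le g x)) _)
    rw [hfin] at h
    rw [hD]
    exact_mod_cast h
  -- (F5) the exceptional primes
  have hω : ((g.leadingCoeff.natAbs).primeFactors.card : ℝ) ≤ 2 * Real.log (D * W) := by
    have ha0 : 0 < g.leadingCoeff.natAbs :=
      Int.natAbs_pos.mpr (Polynomial.leadingCoeff_ne_zero.mpr
        (DegreeOnePrimes.ne_zero_of_fact_irreducible g))
    have h1 := card_primeFactors_mul_log_two_le ha0
    have h2 : Real.log (g.leadingCoeff.natAbs : ℝ) ≤ Real.log (D * W) := by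
      refine Real.log_le_log (by exact_mod_cast ha0) ?_
      rw [Nat.cast_natAbs, Int.cast_abs]
      calc |((g.leadingCoeff : ℤ) : ℝ)| ≤ W := DegreeOnePrimes.abs_leadingCoeff_le hWsum
        _ = 1 * W := (one_mul W).symm
        _ ≤ D * W := mul_le_mul_of_nonneg_right hD1 (by linarith)
    have hlog2 : (1 : ℝ) / 2 < Real.log 2 := by
      have := Real.log_two_gt_d9
      linarith
    have h0 : (0 : ℝ) ≤ (g.leadingCoeff.natAbs).primeFactors.card := Nat.cast_nonneg _
    nlinarith
  -- (F6) `⌊√x⌋ ≤ √x`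
  have hsqrt : ((Nat.sqrt x : ℕ) : ℝ) ≤ Real.sqrt (x : ℝ) := by
    calc ((Nat.sqrt x : ℕ) : ℝ) = Real.sqrt (((Nat.sqrt x : ℕ) : ℝ) ^ 2) :=
          (Real.sqrt_sq (Nat.cast_nonneg _)).symm
      _ ≤ Real.sqrt (x : ℝ) := Real.sqrt_le_sqrt (by exact_mod_cast Nat.sqrt_le' x)
  -- logarithms
  have hDpos : 0 < D := by linarith
  have hWpos : 0 < W := by linarith
  have hlogDW : Real.log (D * W) = Real.log D + Real.log W := Real.log_mul hDpos.ne' hWpos.ne'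
  have hlogD : 0 ≤ Real.log D := Real.log_nonneg hD1
  have hlogW : 0 ≤ Real.log W := Real.log_nonneg hW1
  have hL : 0 ≤ Real.log (D * W) := by rw [hlogDW]; positivity
  have hlX : 1 / 2 ≤ Real.log (x : ℝ) := by
    have := Real.log_two_gt_d9
    have h := Real.log_le_log two_pos hX2
    linarith
  have hlogDWX : Real.log (D * W * x) = Real.log (D * W) + Real.log (x : ℝ) :=
    Real.log_mul (mul_pos hDpos hWpos).ne' (ne_of_gt (by linarith))
  have hldK : Real.log |(NumberField.discr (DegreeOnePrimes.RootField g) : ℝ)| ≤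
      3 * D * Real.log (D * W) := by
    rw [hlogDW]
    have : D * Real.log D + 2 * D * Real.log W ≤ 3 * D * (Real.log D + Real.log W) := by
      nlinarith
    exact hdisc.trans (by rw [hD]; exact this)
  -- assemble
  have hgoal := cor48_bookkeeping (πx := (Nat.primeCounting x : ℝ))
    (N := (rootModPrimeCount g x : ℝ)) hc.le hD1 (Real.sqrt_nonneg (x : ℝ)) hL hlX
    hcount (sub_le_comm.mp (abs_sub_le_iff.mp HK).2) (sub_le_comm.mp (abs_sub_le_iff.mp HQ).1)
    hldK hω hsqrt
  rw [hlogDWX]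
  convert hgoal using 2

/-! ### Consequences: Theorem 4.1, (A3) and `P/poly = NP/poly` from Theorem 4.5 and GRH-PIT -/

variable (k : Type*) [Field k]

/-- **Theorem 4.1 from Theorem 4.5 and the effective prime ideal theorem**
(Bürgisser 2000 TCS, Thm. 4.1 p. 79, "by combining Theorem 4.5, Remark 4.6, and Corollary 4.8",
p. 84): the reduction-modulo-primes theorem `reduction_mod_primes_of_GRH` follows from the
Krick–Pardo height bound `algebraicSolution_height_bound` (TCS Thm. 4.5) and the GRH effective
prime ideal theorem `effectivePrimeIdealTheorem_of_ERH` (Lagarias–Odlyzko; Serre Thm. 4), the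
intermediate Cor. 4.8 being proved above. [cite: Burgisser2000TCS, Thm. 4.1 p. 79 and §4 p. 84] -/
theorem reduction_mod_primes_of_GRH_of_heightBound_of_effectivePrimeIdealTheorem
    (h45 : algebraicSolution_height_bound) (hPIT : effectivePrimeIdealTheorem_of_ERH) :
    reduction_mod_primes_of_GRH :=
  reduction_mod_primes_of_GRH_of_facts h45
    (rootModPrimeCount_lower_bound_of_GRH_of_effectivePrimeIdealTheorem hPIT)

/-- **(A3) from Theorem 4.5 and the effective prime ideal theorem** (Bürgisser 2000 TCS,
Thm. 1.1(1), §5 (A3)): `booleanPart_VP_cktSize k` follows from `algebraicSolution_height_bound`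
and `effectivePrimeIdealTheorem_of_ERH`. [cite: Burgisser2000TCS, Thm. 1.1(1) p. 73 and §5 (A3) pp. 85–86] -/
theorem booleanPart_VP_cktSize_of_heightBound_of_effectivePrimeIdealTheorem
    (h45 : algebraicSolution_height_bound) (hPIT : effectivePrimeIdealTheorem_of_ERH) :
    booleanPart_VP_cktSize k :=
  booleanPart_VP_cktSize_of_reduction_mod_primes k
    (reduction_mod_primes_of_GRH_of_heightBound_of_effectivePrimeIdealTheorem h45 hPIT)

/-- **The target fact from Theorem 4.5 and the effective prime ideal theorem under GRH**:
Bürgisser's `VP_k = VNP_k ⟹ P/poly = NP/poly` in characteristic zero under GRH (TCS 235,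
Cor. 1.2(1), p. 74; book Cor. 4.6(1)), i.e. the named fact
`PPoly_eq_polyAdvice_NP_of_VP_eq_VNP k` of `ValiantBooleanBridge.lean`, follows from the two
named facts `algebraicSolution_height_bound` (TCS Thm. 4.5: algebraic solutions of small height,
after Krick–Pardo) and `effectivePrimeIdealTheorem_of_ERH` (the prime ideal theorem under GRH
with Lagarias–Odlyzko's uniform error term, Serre 1981 Thm. 4). Every other step of the printed
proof — (A2), the Karp–Lipton/Arora–Barak bookkeeping, the constant-free skeleton, the
Nullstellensatz transfer, Chebyshev's bound, the prime selection, the Boolean simulation modulo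
`p`, Remark 4.6, Theorem 4.7/Corollary 4.8 (this file, with `DegreeOnePrimesTailOrder.lean`,
`DegreeOnePrimesDiscriminantBound.lean`, `PrimeIdealCountDegreeOne.lean`) and the
combination giving Theorem 4.1 — is proved in the tree.
[cite: Burgisser2000TCS, Cor. 1.2(1) p. 74] [cite: Burgisser2000, Cor. 4.6(1)] -/
theorem PPoly_eq_polyAdvice_NP_of_VP_eq_VNP_of_heightBound_of_effectivePrimeIdealTheorem
    (h45 : algebraicSolution_height_bound) (hPIT : effectivePrimeIdealTheorem_of_ERH) :
    PPoly_eq_polyAdvice_NP_of_VP_eq_VNP k :=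
  PPoly_eq_polyAdvice_NP_of_VP_eq_VNP_of_reduction_mod_primes k
    (reduction_mod_primes_of_GRH_of_heightBound_of_effectivePrimeIdealTheorem h45 hPIT)

end Literature.Computability.AlgebraicComplexity

end
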